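import Literature.NumberTheory.GaloisRepresentations.CyclicLayerCarry
import HarnessLib

/-!
# Change of level for cyclic classes: `κ_χ(a) = (d'/d) · κ_{χ'}(a)` when `χ = χ' mod d`
# (Serre, *Corps locaux* XIV §1; Cassels–Fröhlich, Exercise 4.4 "`(χ, a)` is additive in `χ`")

Topic `NumberTheory/GaloisRepresentations`; namespace `Literature.NumberTheory.GaloisRepresentations`.
Theorems only (no definition, no named fact, no instance; D-0026).  Sequel to `CyclicLayerCarry.lean`
(`CyclicCharacter`, the carry cocycle `c_χ`, the cyclic classes `cyclicClass χ ρ a = [c_χ ⊗ a] ∈ H²(G, A)`).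

Let `G` be a topological group, `χ' : G ↠ ℤ/d'` and `χ : G ↠ ℤ/d` cyclic characters with `d ∣ d'` and
`χ = χ' mod d` (`χ σ = cast (χ' σ)`), and `A` a discrete `G`-module.  Writing the lifts
`0 ≤ χ̃' < d'`, `0 ≤ χ̃ < d` one has `χ̃' σ = d · ε(σ) + χ̃ σ` with `ε(σ) = ⌊χ̃' σ / d⌋`, whence the carry cocycles
(`d · c_χ(σ,τ) = χ̃ σ + χ̃ τ - χ̃(στ)`) satisfy

  `(d'/d) · c_{χ'}(σ, τ) = c_χ(σ, τ) + ε(σ) + ε(τ) - ε(στ)`        (`div_mul_carryFun_eq`),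

i.e. `(d'/d) · c_{χ'}` and `c_χ` differ by the coboundary of the integer-valued cochain `ε`.  Hence for every
`G`-invariant `a ∈ A`:

  **`cyclicClass χ ρ a = (d'/d) • cyclicClass χ' ρ a`**        (`cyclicClass_eq_div_smul_cyclicClass`),

the cochain form of the bilinearity of the norm-residue symbol `(χ, a) = a ∪ δχ` in the character
(`δ` is additive and `(d'/d) · χ' = χ` in `Hom(G, ℚ/ℤ)` under `ℤ/d ↪ ℤ/d'`).  Special case used downstream
(`ℤ_p`-towers, `χ_m = κ mod p^m`): `κ_{χ_m}(a) = p • κ_{χ_{m+1}}(a)`, so cyclic classes attached to the layers of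
a `ℤ_p`-extension are `p`-divisible to all orders (`cyclicClass_eq_smul_cyclicClass_of_mul`).

HONEST FRAMING: cochain bookkeeping for the tree's cyclic classes; no arithmetic statement is proved here.
Written for crux K4 `SignedControlAtTwo` (stmt-BirchSwinnertonDyer-20309) of `Summits/BirchSwinnertonDyer`, input (hBr)
of `ShaThree.realThree_injective_orderTwo_of_brauer` (a Brauer class with trivial real invariants is twice a class).

## References
* J.-P. Serre, *Corps locaux* (1968) / *Local Fields* (1979), XIV §1 (the symbol `(χ, b) = b ∪ δχ`, bilinear).
  [SerreLocalFields1979]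
* J. W. S. Cassels, A. Fröhlich (eds.), *Algebraic Number Theory* (1967), Exercise 4 (p. 353). [CasselsFrohlichANT1967]

## Tree search
`lean search 'cyclicClass'`: `CyclicLayerCarry` (definition, `cyclicClass_cycNorm`, `exists_cycNorm_eq_of_cyclicClass_eq_zero`),
`CyclicClassRestrict` (`nsmul_cyclicClass_eq_zero`, `map_cyclicClass_eq_cyclicClass_derived` — restriction along a
group homomorphism, the DERIVED character), `BrauerCyclicLayer`, `LocalInvariantOfUnramifiedClass` — no change-of-level
statement between two characters of the same group.
-/

noncomputable section

open CategoryTheory Function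

universe u

namespace Literature.NumberTheory.GaloisRepresentations

open _root_.TopRep _root_.ContRepresentation _root_.ContinuousCohomology

namespace CyclicCharacter

/-! ### §1. The lifts of `χ = χ' mod d`: `χ̃' = d · ε + χ̃` -/

section Lift

variable {G : Type u} [Group G] [TopologicalSpace G] {d d' : ℕ} [NeZero d] [NeZero d']
variable (χ : CyclicCharacter G d) (χ' : CyclicCharacter G d') (hdd : d ∣ d')
variable (hχ : ∀ σ, χ σ = ZMod.castHom hdd (ZMod d) (χ' σ))

omit [NeZero d] in
include hχ in
/-- `χ̃ σ = χ̃' σ mod d` for `χ = χ' mod d`. [folklore] -/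
private theorem val_eq_val_mod_of_castHom (σ : G) : (χ σ).val = (χ' σ).val % d := by
  rw [hχ σ, ZMod.castHom_apply, ZMod.cast_eq_val, ZMod.val_natCast]

omit [NeZero d] in
include hχ in
/-- `χ̃' σ = d · ⌊χ̃' σ / d⌋ + χ̃ σ` for `χ = χ' mod d`. [folklore] -/
private theorem val_eq_mul_div_add_val_of_castHom (σ : G) : (χ' σ).val = d * ((χ' σ).val / d) + (χ σ).val := by
  rw [val_eq_val_mod_of_castHom χ χ' hdd hχ σ]
  exact (Nat.div_add_mod _ _).symm

include hχ in
/-- **The two carry cocycles differ by a coboundary**: `(d'/d) · c_{χ'}(σ,τ) = c_χ(σ,τ) + ε σ + ε τ - ε(στ)` with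
`ε σ = ⌊χ̃' σ / d⌋`, for `χ = χ' mod d`, `d ∣ d'`. [cite: SerreLocalFields1979, XIV §1] -/
theorem div_mul_carryFun_eq (σ τ : G) :
    ((d' / d : ℕ) : ℤ) * χ'.carryFun σ τ =
      χ.carryFun σ τ + (((χ' σ).val / d : ℕ) : ℤ) + (((χ' τ).val / d : ℕ) : ℤ) -
        (((χ' (σ * τ)).val / d : ℕ) : ℤ) := by
  obtain ⟨k, hk⟩ := hdd
  have hd0 : (d : ℤ) ≠ 0 := Int.natCast_ne_zero.2 (NeZero.ne d)
  have hdpos : 0 < d := Nat.pos_of_ne_zero (NeZero.ne d)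
  have hkd : d' / d = k := by rw [hk, Nat.mul_div_cancel_left k hdpos]
  rw [hkd]
  apply mul_left_cancel₀ hd0
  -- `d · (k · c') = d' · c' = χ̃'σ + χ̃'τ - χ̃'(στ)` and `d · c = χ̃σ + χ̃τ - χ̃(στ)`
  have h' := χ'.natCast_mul_carryFun σ τ
  have h := χ.natCast_mul_carryFun σ τ
  have eσ := val_eq_mul_div_add_val_of_castHom χ χ' ⟨k, hk⟩ hχ σ
  have eτ := val_eq_mul_div_add_val_of_castHom χ χ' ⟨k, hk⟩ hχ τ
  have eστ := val_eq_mul_div_add_val_of_castHom χ χ' ⟨k, hk⟩ hχ (σ * τ)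
  have hcast : (d' : ℤ) = (d : ℤ) * (k : ℤ) := by exact_mod_cast hk
  rw [hcast] at h'
  have eσ' : ((χ' σ).val : ℤ) = (d : ℤ) * (((χ' σ).val / d : ℕ) : ℤ) + ((χ σ).val : ℤ) := by exact_mod_cast eσ
  have eτ' : ((χ' τ).val : ℤ) = (d : ℤ) * (((χ' τ).val / d : ℕ) : ℤ) + ((χ τ).val : ℤ) := by exact_mod_cast eτ
  have eστ' : ((χ' (σ * τ)).val : ℤ) = (d : ℤ) * (((χ' (σ * τ)).val / d : ℕ) : ℤ) + ((χ (σ * τ)).val : ℤ) := by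
    exact_mod_cast eστ
  calc (d : ℤ) * ((k : ℤ) * χ'.carryFun σ τ) = (d : ℤ) * (k : ℤ) * χ'.carryFun σ τ := by ring
    _ = ((χ' σ).val : ℤ) + ((χ' τ).val : ℤ) - ((χ' (σ * τ)).val : ℤ) := h'
    _ = (d : ℤ) * (χ.carryFun σ τ + (((χ' σ).val / d : ℕ) : ℤ) + (((χ' τ).val / d : ℕ) : ℤ) -
          (((χ' (σ * τ)).val / d : ℕ) : ℤ)) := by
        rw [eσ', eτ', eστ', mul_sub, mul_add, mul_add, h]; ring

end Lift

/-! ### §2. `κ_χ(a) = (d'/d) • κ_{χ'}(a)` -/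

section Classes

variable {G : Type u} [Group G] [TopologicalSpace G] [IsTopologicalGroup G] [LocallyCompactSpace G]
variable {d d' : ℕ} [NeZero d] [NeZero d']
variable (χ : CyclicCharacter G d) (χ' : CyclicCharacter G d') (hdd : d ∣ d')
variable (hχ : ∀ σ, χ σ = ZMod.castHom hdd (ZMod d) (χ' σ))
variable {A : Type u} [AddCommGroup A] [TopologicalSpace A] [DiscreteTopology A]
variable (ρ : ContinuousRep G ℤ A)

include hχ in
/-- **Change of level for cyclic classes: `κ_χ(a) = (d'/d) • κ_{χ'}(a)`** in `H²(G, A)` for `χ = χ' mod d`,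
`d ∣ d'`, and a `G`-invariant `a` — the cocycles `c_{χ'} ⊗ ((d'/d) · a)` and `c_χ ⊗ a` differ by the coboundary of
`σ ↦ -⌊χ̃' σ / d⌋ · a`.  (Bilinearity of `(χ, a) = a ∪ δχ` in `χ`.) [cite: SerreLocalFields1979, XIV §1]
[cite: CasselsFrohlichANT1967, Exercise 4] -/
theorem cyclicClass_eq_div_smul_cyclicClass (a : ρ.toTopRep.ρ.invariants) :
    cyclicClass χ ρ a = (d' / d : ℕ) • cyclicClass χ' ρ a := by
  rw [← map_nsmul]
  have ha : ∀ g : G, ρ g a.1 = a.1 := a.2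
  have hka : ((((d' / d : ℕ) • a : ρ.toTopRep.ρ.invariants) : A)) = ((d' / d : ℕ) : ℤ) • a.1 := by
    rw [Submodule.coe_smul_of_tower, natCast_zsmul]
  change twoCocycleClass _ (carryCocycle χ ρ a.1 a.2) =
    twoCocycleClass _ (carryCocycle χ' ρ ((d' / d : ℕ) • a).1 ((d' / d : ℕ) • a).2)
  rw [← sub_eq_zero, ← twoCocycleClass_sub, twoCocycleClass_eq_zero_iff]
  -- the coboundary of `σ ↦ -⌊χ̃' σ / d⌋ · a`
  refine ⟨⟨fun σ => -((((χ' σ).val / d : ℕ) : ℤ) • a.1),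
    (continuous_of_discreteTopology (f := fun x : ZMod d' => -(((x.val / d : ℕ) : ℤ) • a.1))).comp χ'.continuous⟩,
    fun σ τ => ?_⟩
  change χ.carryFun σ τ • a.1 - χ'.carryFun σ τ • (((d' / d : ℕ) • a : ρ.toTopRep.ρ.invariants) : A) =
    ρ σ (-((((χ' τ).val / d : ℕ) : ℤ) • a.1)) - -((((χ' (σ * τ)).val / d : ℕ) : ℤ) • a.1) +
      -((((χ' σ).val / d : ℕ) : ℤ) • a.1)
  rw [hka, map_neg, map_zsmul, ha, smul_smul, mul_comm, div_mul_carryFun_eq χ χ' hdd hχ σ τ, ← sub_smul]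
  rw [show χ.carryFun σ τ - (χ.carryFun σ τ + (((χ' σ).val / d : ℕ) : ℤ) + (((χ' τ).val / d : ℕ) : ℤ) -
      (((χ' (σ * τ)).val / d : ℕ) : ℤ)) = -(((χ' τ).val / d : ℕ) : ℤ) - -(((χ' (σ * τ)).val / d : ℕ) : ℤ) +
      -(((χ' σ).val / d : ℕ) : ℤ) by ring, add_smul, sub_smul, neg_smul, neg_smul, neg_smul]

include hχ in
/-- The same with the level written as a product `d' = d · k`: **`κ_χ(a) = k • κ_{χ'}(a)`** for `χ = χ' mod d`.
For the layers `χ_m = κ mod p^m` of a `ℤ_p`-tower (`p^{m+1} = p^m · p`): `κ_{χ_m}(a) = p • κ_{χ_{m+1}}(a)`.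
[cite: SerreLocalFields1979, XIV §1] -/
theorem cyclicClass_eq_smul_cyclicClass_of_mul {k : ℕ} (hk : d' = d * k) (a : ρ.toTopRep.ρ.invariants) :
    cyclicClass χ ρ a = k • cyclicClass χ' ρ a := by
  have hkd : d' / d = k := by rw [hk, Nat.mul_div_cancel_left k (Nat.pos_of_ne_zero (NeZero.ne d))]
  rw [cyclicClass_eq_div_smul_cyclicClass χ χ' hdd hχ ρ a, hkd]

include hχ in
/-- **Divisibility**: a cyclic class for `χ = χ' mod d` with `d' = d · k` is `k` times a class of `H²(G, A)`.
[cite: SerreLocalFields1979, XIV §1] -/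
theorem exists_eq_smul_of_cyclicClass_of_mul {k : ℕ} (hk : d' = d * k) (a : ρ.toTopRep.ρ.invariants) :
    ∃ z : continuousCohomology 2 ρ.toTopRep, cyclicClass χ ρ a = k • z :=
  ⟨cyclicClass χ' ρ a, cyclicClass_eq_smul_cyclicClass_of_mul χ χ' hdd hχ ρ hk a⟩

end Classes

end CyclicCharacter

end Literature.NumberTheory.GaloisRepresentations

end
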